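import Summits.AtomisticToContinuum.HydrodynamicLimit.Theses.TwoClocks
import Summits.AtomisticToContinuum.HydrodynamicLimit.Theses.OneFlightGossipEngine
import Summits.AtomisticToContinuum.HydrodynamicLimit.Theorems.DenseExcursion.Negative.AtTimeZero
import Summits.AtomisticToContinuum.HydrodynamicLimit.Theorems.DenseExcursion.Negative.Untied
import Summits.AtomisticToContinuum.HydrodynamicLimit.Theorems.OneFlightGossipEngineCollisionActivityTailsEndpointTails
import Summits.AtomisticToContinuum.HydrodynamicLimit.Theorems.OneFlightGossipEngineClampedCurrentsDockTransferTails

/-!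
# Disproof of `TransferActivityTails` — findings: NO KILL (cycle 1); the crux is the 13734 statement plus an
# energy twin, reduces UNCONDITIONALLY to its global-equilibrium rung, and every cheap attack (junk models,
# degenerate parameters, fast particles, Newton-cradle energy relays, Galilean boosts, hypothesis mutation)
# either hits a strictly stronger statement or is priced out by the `L¹` currency

Crux: `Summit.AtomisticToContinuum.HydrodynamicLimit.Theses.TwoClocks.TransferActivityTails`
(stmt-AtomisticToContinuum-16624; route TwoClocks crux #7; rev-10 restatement of ex-stmt-13734
`CollisionActivityTails` with the TRANSFER activity of the repaired collisional crux C′ = `ClampedTransferWindowLD`).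
Standing adversary: refuter-cdisprove-stmt-AtomisticToContinuum-16624-0, cycle 1 (2026-08-16).  Prose lives in
docstrings; the file is `lean check`ed sorry-free (rc 0).

LANDED (this cycle, all under `Theorems/TransferActivityTails/Negative/`, namespace
`Theorems.TransferActivityTailsNegative`, importable): `EquilibriumReduction.lean` (p127163 ACCEPTED) = §1–§3 of
this file verbatim (this workfile keeps its own copy, written before the landing); `ExpMomentLattice.lean`
(p127536 ACCEPTED) + `ExpMomentFalse.lean` (p127643 ACCEPTED) = the Lean REFUTATION of the exponential-moment
(LD) strengthening `TransferActivityTailsExpMoment` (§5) by the 13733 Newton-cradle relay —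
`TransferActivityTailsNegative.transferActivityTailsExpMoment_false`, sorry-free, axioms
{propext, Classical.choice, Quot.sound}; this workfile's §5 def is byte-identical with the landed one (`Iff.rfl`), so
`¬ TransferActivityTailsExpMoment` here is `fun h => TransferActivityTailsNegative.transferActivityTailsExpMoment_false h`
(the importing variant `Disproof_v3full.lean` sits in the disprover's folder until the farm has built the new olean).

INHERITED (read, cited, not re-run): the 13734 disprover's `Cruxes/CollisionActivityTails/Disproof.lean` v8
(two cycles, NO KILL: junk audit, SHAPE analysis `CruxShape ⇒ UIShape` strictly, load-bearing `V₀ > 0` and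
`τ → ∞`, equilibrium reduction, UI/fraction split, hub/platoon budget arithmetic) — every item there is generic
in the per-record summand and therefore applies VERBATIM to this crux through `tailsOf_of_le` (§2); and the
ideator-2 notes `Cruxes/TransferActivityTails/NOTES.md` (count/impulse dichotomy: Burago–Ivanov 2018 counts vs
Serre 2021 / Lagrange–Jacobi impulse caps; the energy row does NOT reduce to the momentum row by kinematics;
(N1) = Eulerian fluidity ∧ no Lagrangian focus; (N2) = clump moments of order 4/3).
WARNING for readers of the 13734 files: `Theorems/CollisionActivityTails/Negative/EquilibriumReduction.lean` and
`Cruxes/CollisionActivityTails/Disproof.lean` refer to the RETIRED decl `TwoClocks.CollisionActivityTails` and no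
longer elaborate at HEAD (cached oleans mask it); the live momentum statement is
`OneFlightGossipEngine.CollisionActivityTails` (= `MomentumActivityTails` here, `Iff.rfl`, §1).

## The statement, read back (`transferActivityTails_iff`, definitional)

For all continuous profiles `a₀ > 0`, `θ₀ > 0`, `u₀`: `∃ σ₀ > 0 ∀ 0 < σ < σ₀`, every horizon `T`, every
classical hs-Euler solution `(ρ,u,θ)` on `[0,T)`, every family of hard-sphere flows `Φ N` (`N+1` spheres of
diameter `ε_N = σ(N+1)^{-1/3}` on `𝕋³`): IF the local Gibbs laws `λ_N = localGibbsLaw σ a₀ u₀ θ₀ N (Φ N)`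
satisfy the hydrodynamic LLN at `t = 0` towards `(ρ,u,θ)(0)`, THEN for every `t ∈ [0,T)`:
`∃ V₀ > 0 ∀ V ≥ V₀ ∀ ε > 0 ∃ τ₀ > 0 ∀ τ ≥ τ₀ ∃ N₀ ∀ N ≥ N₀ ∀ s ∈ [0,t]`,
`E_{λ_N}[(N+1)⁻¹ Σᵢ aᵢ 𝟙{aᵢ > V}] ≤ ε`, `aᵢ = (σ/τ) Σ_{collisions of i with times in (s, s+w]}
(‖vᵢ⁺ − vᵢ⁻‖ + |‖vᵢ⁺‖² − ‖vᵢ⁻‖²|/2)` along the orbit of the initial datum, `w = τ(N+1)^{-1/3}`.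
In words: `lim_{τ→∞} limsup_{N→∞} sup_{s≤t} E[(N+1)⁻¹Σ aᵢ𝟙{aᵢ>V}] = 0` for every `V ≥ V₀(profiles, σ, Φ, t)`.

Coercion / junk audit (all benign; re-run for the energy summand): `∫⁻ ∘ ENNReal.ofReal` of a nonnegative real
(`transferOf_nonneg`, `collisionSum_nonneg`); `λ_N ≪` Liouville (`ae_mem_good_localGibbsLaw`), a probability
measure for `σ ≤ 1/2`, the ZERO measure if the spheres cannot fit (then trivially true, never false);
`collisionSum` is a `finsum` over the ORBIT's collision times — derived from `Φ.flow`, NOT a free field of the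
structure (no junk-flow witness: `HardSphereFlow` demands genuine hard-sphere trajectories on a conull invariant
good set), junk `0`/arbitrary only for infinitely many collision times in the window (off the good set, null);
the energy summand `|‖v⁺‖² − ‖v⁻‖²|/2` is read off the same record as the momentum summand (post-collisional
configuration + elastic law), and equals `‖Δvᵢ‖ · |⟪(vᵢ+vⱼ)/2, n̂⟫|` EXACTLY (`ofConfig_energy_jump`, §4):
momentum impulse × normal centre-of-mass speed — NOT Galilean invariant (a boost `U` shifts it by `⟪U,n̂⟫‖Δvᵢ‖`),
which is harmless because `V₀` is chosen after the profiles (`u₀`); `T ≤ 0` vacuous; `N₀` after `τ`,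
`s`-uniformity after `N₀` — the intended order (w → 0 at fixed τ).  The statement ELABORATES (probe rc 0).

## Findings (cycle 1) — NO KILL, no misstatement

1. STRUCTURE (§1–§2, checked): the crux is `TailsOf transferOf` and `TailsOf` is ANTITONE in a nonnegative
   summand (`tailsOf_of_le`).  Hence crux ⇒ `MomentumActivityTails` (≡ `OneFlightGossipEngine.CollisionActivityTails`,
   `momentumActivityTails_iff_oneFlight`) and crux ⇒ `EnergyActivityTails` (≡ the registered twin
   `ClampedCurrentsDockTransferTails.CollisionEnergyActivityTails`, `energyActivityTails_iff_twin`); with the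
   landed converse `ClampedCurrentsDockTransferTails.stub_transferActivityTails` the crux is EQUIVALENT to
   13734 ∧ twin (`transferActivityTails_iff_momentum_and_energy`).  Consequence: every negative result and every
   dead line recorded against 13734 is a result about THIS crux; a kill of either conjunct kills it.
2. EQUILIBRIUM REDUCTION (§3, checked, UNCONDITIONAL): crux ⇒ `EquilibriumTransferActivityTails` (constant
   profiles; constant Euler states `isHardSphereEulerSolution_const`; the constant-profile LLN has a CONSTANT
   density, `constantStateLLN`, with `σ₁ ≤ 1/2` and the probability clause) — the `N`-uniform tagged-particle
   transfer-activity LLN over `τσ² → ∞` mean free times under the invariant canonical Gibbs law.  This is the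
   natural refutation target (`not_transferActivityTails_of_not_equilibrium`): no Euler solution, no LLN
   hypothesis, explicit invariant law.
3. ENERGY-SPECIFIC ATTACKS (§4; all fail, reasons quantified):
   (a) fast particles at `s = 0` (Maxwellian tail): a sphere of speed `u` dumps `≈ u²/2` once while
       thermalising, `aᵉ ≈ (σ/τ)u²/2 > V` needs `u² ≳ 2Vτ/σ`, contribution `≲ V·exp(−Vτ/(2σθ₀)) → 0`;
       under the TRUE law at `s > 0` the one-dump channel is `≤ (σ/τ)·KE/(N+1) = O(σ/τ) → 0` by energy
       conservation — hyperactivity in energy currency needs REPEATED exchanges, i.e. a relay or a cage;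
   (b) Newton-cradle energy relay (the 13733 Lean witness, transfer activity `≍ σt²` at momentum activity
       `2σ/t`, `τ = t⁴`): pinning cost `≥ c(N+1)·log(tl)` nats ⇒ Gibbs weight `e^{−c(N+1)log(tl)}`, so its `L¹`
       contribution `→ 0` as `N → ∞` — the relay kills only the EXPONENTIAL-MOMENT strengthening
       `TransferActivityTailsExpMoment` (§5), and that kill is now a LEAN THEOREM
       (`TransferActivityTailsNegative.transferActivityTailsExpMoment_false`, landed `Negative/ExpMomentLattice.lean`
       + `Negative/ExpMomentFalse.lean`, re-using the 13733 `Negative/*` lattice machinery: every receiver of a pulse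
       transfer has activity `≥ (σ/τ)·clo(clo−2u)/2 ≥ (9/100)t²/l² > V`, receivers are distinct, `≥ (N+1)/6`
       transfers, so `2Σᵢaᵢ𝟙{aᵢ>V} ≥ Fmin N kw 1 1` and the 13733 final inequality closes at `β = 2`, `ε = 1`);
       CONSEQUENCE FOR PLANNERS/PROVERS: the pre-shock (`s > 0`) half of the crux can NOT be priced from ANY
       equilibrium statement about this functional through the entropy inequality
       `E_λ[X] ≤ γ⁻¹(H(λ|G) + log E_G e^{γX})` with `H ≤ κ(N+1)`: that needs
       `log E_G exp(γ Σᵢaᵢ𝟙{aᵢ>V}) = o(N+1)·…` at some FIXED tilt `γ > 0`, which is exactly the refuted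
       `TransferActivityTailsExpMoment` (false at every `β > 0`, every `V`, all large `τ`) — the crux text's
       "(not obtainable from entropy)" is now a theorem for the exponential-Chebyshev route; a proof at `s > 0`
       must propagate an `L¹`/in-probability property of the TRUE law by a dynamical argument;
   (c) Galilean boost `u₀ ≠ 0`: energy activity mean `≈ (√θ₀ + |u₀|)·6θ₀(Z−1)`, absorbed by `V₀(u₀)`;
   (d) the ideator's kinematic non-reduction (energy row ≠ momentum row + kinetic tails) cuts both ways: no
       cheap DISPROOF of the energy row from momentum facts either.
4. LOAD-BEARING HYPOTHESES (§5, typed; paper verdicts, as for 13734): `V₀ > 0` (no-threshold variant = mean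
   activity → 0: FALSE, virial `E_G a ≥ 6θ₀(Z−1) + energy part > 0`) and `τ → ∞` (all-windows variant: FALSE,
   a sub-mean-free-time window puts its whole mean above any `V`); both are STRENGTHENINGS
   (`tailsOf_of_noThreshold`, `tailsOf_of_allWindows`), so their falsity does not touch the crux.  Neither
   falsity is Lean-closable today: each needs a collision-rate FLOOR IN MEAN along the flow from Gibbs data.
   Inventory for whoever wants it: stationarity of `G` is landed
   (`BoltzmannGreenKubo/Negative/Stationarity.measurePreserving_flow_localGibbsLaw`), the STATIC tube floor is
   landed (`Literature…CollisionTubePairMeanLowerBound`: pair tube mean ≥ ½ ideal, no cluster expansion), the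
   PATHWISE cylinder pull-back is landed (`Literature…CollisionTubePullbackAssembly.collisionSum_sub_integral_tubeStat_le`:
   collision sum = ∫ tube functional along the orbit up to mismatch / three-body / shell corrections), and the
   flux UPPER bounds are landed (`CollisionFluxUpperBound`, `HardSphereMeanCollisionCount`); what is NOT is the
   mean control of the corrections (short-flight deficit, three-body count) — the open rung-0 stubs of
   `JParityClosure.RateFloor` / `InformationPercolationEngine.CollisionRate`.  A rate floor in mean would make
   `¬TailsOfNoThreshold transferOf`, `¬TailsOfAllWindows transferOf`, "no profile-uniform `V₀`" (Galilean
   growth of the energy activity with `|u₀|`) and "`V₀ ≥` Gibbs mean" Lean theorems at once.  The Euler solution and the `t = 0` LLN are DECORATION except for the horizon `T` (the conclusion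
   never mentions `ρ,u,θ`; `V₀` may depend on `t`); for global smooth data (constant states, steady shears)
   the crux claims tails at every `t ≥ 0`.  `σ < σ₀(profiles)` is existential-universal in the right order and
   cannot be attacked (dense/glassy regimes excluded by choosing `σ₀` small).
5. WHY IT RESISTS (substance, = 13734 §5 + the energy row): a counterexample must make the TRUE pre-shock law
   carry a non-vanishing ACTIVITY-WEIGHTED `L¹` mass above a fixed level over `τσ² → ∞` mean free times —
   at equilibrium: non-ergodic tagged impulse/energy-transfer rates (persistent overpressured cages or
   recurrent relays with positive weighted probability); off equilibrium: spontaneous mesoscopic focusing at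
   `O(1)` probability (entropy allows Gibbs-cost `e^{−κN}` events, nothing constructs them).  No rigorous tool
   controls deterministic hard-sphere dynamics at fixed density beyond Lanford's time in either direction.
   Verdict: OPEN, physically true (local equilibrium + tagged-particle LLN), formally tight, not refutable with
   present tools; its negation would sink the local-equilibrium picture itself (KILL CRITERIA of the route).
6. SEARCHES (2026-08-16, this seat): `lit search` local index: searchd connection reset (degraded); OpenAlex:
   HTTP 429 (daily budget exhausted); arXiv cascade: 0 rows; `lit galaxy search --star all` substring ×2: 0 rows;
   galaxy bm25 (pdf): 12 rows, none on tagged-particle collision-rate LLNs of ELASTIC hard spheres (nearest: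
   clustering / inelastic collapse in GRANULAR gases — Luding 1998, Alvarez-Hamelin–Puglisi — a dissipative
   mechanism absent here).  `search-degraded` recorded; literature status inherited from 13734 §7e and the
   ideator notes (Serre 2021/2024, Burago–Ferleger–Kononenko 1998, Burago–Ivanov 2018, Simányi 2013,
   BGSS 2023): no printed counterexample, no printed proof.

## Index
* §1 `Flow`, `Rec`, `Cfg`, `transferOf/momentumOf/energyOf`, `TailsOf`, `transferActivityTails_iff`,
  `MomentumActivityTails`, `EnergyActivityTails`, `momentumActivityTails_iff_oneFlight`, `energyActivityTails_iff_twin`.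
* §2 `collisionSum_nonneg`, `collisionSum_mono_of_good`, `tailsOf_of_le`, `…_nonneg`, `…_le_transferOf`,
  `momentumActivityTails_of_crux`, `energyActivityTails_of_crux`, `transferActivityTails_iff_momentum_and_energy`,
  contrapositives.
* §3 `EquilibriumTailsOf`, `EquilibriumTransferActivityTails`, `ConstantStateLLNStatement`, `constantStateLLN`,
  `equilibriumTailsOf_of_tailsOf`, `equilibriumTransferActivityTails_of_crux`,
  `not_transferActivityTails_of_not_equilibrium`.
* §4 `reflectVel_energy_jump`, `ofConfig_energy_jump` (energy impulse = momentum impulse × normal c.o.m. speed).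
* §5 `TailsOfNoThreshold`, `tailsOf_of_noThreshold`, `TailsOfAllWindows`, `tailsOf_of_allWindows`,
  `TransferActivityTailsExpMoment` (typed LD strengthening; REFUTED in Lean by the landed
  `TransferActivityTailsNegative.transferActivityTailsExpMoment_false`, `Negative/ExpMomentLattice.lean` + `Negative/ExpMomentFalse.lean`).
* §6 Targets: none this cycle (no line picked; `stuck_stubs = []`).
-/

noncomputable section

open MeasureTheory Filter Set Topology
open scoped ENNReal InnerProductSpace

namespace Summit.AtomisticToContinuum.HydrodynamicLimit.Cruxes.TransferActivityTails.Disproof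

open Literature.MathematicalPhysics.KineticTheory Literature.Analysis.FluidPDE
open Summit.AtomisticToContinuum.HydrodynamicLimit.Theorems
open DenseExcursionAtTimeZero (density_zero_eq_rhoLim)
open DenseExcursionUntied (isHardSphereEulerSolution_const)
open CollisionActivityTailsEndpointTails (ae_mem_good_localGibbsLaw)

/-! ## §1 The crux with a general summand -/

/-- A hard-sphere flow of `N + 1` spheres of reduced diameter `σ` on `𝕋³` (the crux's `Φ N`). -/
abbrev Flow (σ : ℝ) (N : ℕ) : Type :=
  HardSphereFlow (Torus.geometry (Fin 3)) (hsDiameter σ N) (N + 1)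

/-- Collision records of `N + 1` spheres on `𝕋³`. -/
abbrev Rec (N : ℕ) : Type := HardSphereCollisionRecord (Fin 3) T3 (N + 1)

/-- Phase space of `N + 1` spheres. -/
abbrev Cfg (N : ℕ) : Type := Config (N + 1) (Fin 3) T3

/-- The crux's summand: the TRANSFER impulse (momentum + energy) received by `i` in the ordered record `c`. -/
def transferOf (N : ℕ) (i : Fin (N + 1)) (c : Rec N) : ℝ :=
  if c.fst = i then ‖c.postVel.1 - c.preVel.1‖ + |‖c.postVel.1‖ ^ 2 - ‖c.preVel.1‖ ^ 2| / 2 else 0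

/-- The momentum impulse received by `i` in the record `c` (summand of ex-stmt-13734). -/
def momentumOf (N : ℕ) (i : Fin (N + 1)) (c : Rec N) : ℝ :=
  if c.fst = i then ‖c.postVel.1 - c.preVel.1‖ else 0

/-- The energy impulse received by `i` in the record `c` (summand of the energy twin). -/
def energyOf (N : ℕ) (i : Fin (N + 1)) (c : Rec N) : ℝ :=
  if c.fst = i then |‖c.postVel.1‖ ^ 2 - ‖c.preVel.1‖ ^ 2| / 2 else 0

/-- **The pre-shock window-activity tail statement for a general per-record summand `F`** (the crux's frame
verbatim). -/
def TailsOf (F : (N : ℕ) → Fin (N + 1) → Rec N → ℝ) : Prop :=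
  ∀ (a₀ θ₀ : T3 → ℝ) (u₀ : T3 → V3), Continuous a₀ → Continuous θ₀ → Continuous u₀ →
    (∀ x, 0 < a₀ x) → (∀ x, 0 < θ₀ x) → ∃ σ₀ : ℝ, 0 < σ₀ ∧ ∀ σ : ℝ, 0 < σ → σ < σ₀ →
    ∀ (T : ℝ) (ρ θ : ℝ → T3 → ℝ) (u : ℝ → T3 → V3), IsHardSphereEulerSolution σ T ρ u θ →
    ∀ Φ : (N : ℕ) → Flow σ N,
    TendstoHydroFieldsAt (fun N => localGibbsLaw σ a₀ u₀ θ₀ N (Φ N)) Φ ρ u θ 0 →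
    ∀ t ∈ Set.Ico 0 T, ∃ V₀ : ℝ, 0 < V₀ ∧ ∀ V : ℝ, V₀ ≤ V → ∀ ε : ℝ, 0 < ε →
    ∃ τ₀ : ℝ, 0 < τ₀ ∧ ∀ τ : ℝ, τ₀ ≤ τ → ∃ N₀ : ℕ, ∀ N : ℕ, N₀ ≤ N → ∀ s ∈ Set.Icc 0 t,
      ∫⁻ z, ENNReal.ofReal (((N : ℝ) + 1)⁻¹ * ∑ i : Fin (N + 1),
          Set.indicator {y : ℝ | V < y} (fun y => y)
            (σ / τ * (Φ N).collisionSum (Set.Ioc s (s + τ * ((N : ℝ) + 1) ^ (-(1 / 3 : ℝ))))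
              (F N i) z))
        ∂(localGibbsLaw σ a₀ u₀ θ₀ N (Φ N)) ≤ ENNReal.ofReal ε

/-- **Read-back**: the crux IS `TailsOf transferOf` (definitional unfolding of its `let`s). -/
theorem transferActivityTails_iff :
    Summit.AtomisticToContinuum.HydrodynamicLimit.Theses.TwoClocks.TransferActivityTails ↔
      TailsOf transferOf :=
  Iff.rfl

/-- The momentum-activity tails (ex-crux stmt-13734). -/
def MomentumActivityTails : Prop := TailsOf momentumOf

/-- The energy-activity tails (the twin). -/
def EnergyActivityTails : Prop := TailsOf energyOf

/-- `MomentumActivityTails` IS the live route decl `OneFlightGossipEngine.CollisionActivityTails` (byte-identical). -/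
theorem momentumActivityTails_iff_oneFlight :
    MomentumActivityTails ↔
      Summit.AtomisticToContinuum.HydrodynamicLimit.Theses.OneFlightGossipEngine.CollisionActivityTails :=
  Iff.rfl

/-- `EnergyActivityTails` IS the registered twin `ClampedCurrentsDockTransferTails.CollisionEnergyActivityTails`. -/
theorem energyActivityTails_iff_twin :
    EnergyActivityTails ↔ ClampedCurrentsDockTransferTails.CollisionEnergyActivityTails :=
  Iff.rfl

/-- The crux IS the registered `ClampedCurrentsDockTransferTails.TransferActivityTails` (byte-identical). -/
theorem transferActivityTails_iff_dock :
    Summit.AtomisticToContinuum.HydrodynamicLimit.Theses.TwoClocks.TransferActivityTails ↔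
      ClampedCurrentsDockTransferTails.TransferActivityTails :=
  Iff.rfl

/-! ## §2 Domination: the statement is antitone in a nonnegative summand -/

variable {σ : ℝ} {N : ℕ}

/-- A collision sum of a nonnegative functional is nonnegative (every datum, including the junk case). -/
theorem collisionSum_nonneg (Φ : Flow σ N) (S : Set ℝ) {F : Rec N → ℝ} (hF : ∀ c, 0 ≤ F c)
    (z : Cfg N) : 0 ≤ Φ.collisionSum S F z := by
  rw [HardSphereFlow.collisionSum_eq, collisionSum_eq_collisionPairSum]
  exact collisionPairSum_nonneg fun _ _ _ => hF _

/-- On the good set a window collision sum is monotone in the functional. -/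
theorem collisionSum_mono_of_good (Φ : Flow σ N) {z : Cfg N} (hz : z ∈ Φ.good)
    (a b : ℝ) {F G : Rec N → ℝ} (h : ∀ c, F c ≤ G c) :
    Φ.collisionSum (Set.Ioc a b) F z ≤ Φ.collisionSum (Set.Ioc a b) G z := by
  have hfin := Φ.finite_collisionTimes_inter hz (S := Set.Ioc a b) Set.Ioc_subset_Icc_self
  rw [HardSphereFlow.collisionSum_eq, HardSphereFlow.collisionSum_eq, collisionSum_eq_collisionPairSum,
    collisionSum_eq_collisionPairSum]
  exact collisionPairSum_mono hfin fun _ _ _ _ => h _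

/-- `y ↦ y·𝟙{V < y}` is monotone on `[0, ∞)`. -/
theorem tail_mono {V p q : ℝ} (hp : 0 ≤ p) (hpq : p ≤ q) :
    Set.indicator {y : ℝ | V < y} (fun y => y) p ≤ Set.indicator {y : ℝ | V < y} (fun y => y) q := by
  by_cases h : V < p
  · rw [Set.indicator_of_mem (show p ∈ {y : ℝ | V < y} from h),
      Set.indicator_of_mem (show q ∈ {y : ℝ | V < y} from h.trans_le hpq)]
    exact hpq
  · rw [Set.indicator_of_notMem (show p ∉ {y : ℝ | V < y} from h)]
    exact Set.indicator_apply_nonneg fun _ => hp.trans hpq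

/-- `y·𝟙{V < y} ≤ y` on `[0, ∞)`. -/
theorem tail_le_self {V y : ℝ} (hy : 0 ≤ y) : Set.indicator {y : ℝ | V < y} (fun y => y) y ≤ y :=
  Set.indicator_apply_le' (fun _ => le_rfl) (fun _ => hy)

/-- **Domination.** If `0 ≤ F ≤ G` record by record, the tail statement for `G` implies the one for `F`. -/
theorem tailsOf_of_le {F G : (N : ℕ) → Fin (N + 1) → Rec N → ℝ} (hF : ∀ N i c, 0 ≤ F N i c)
    (hFG : ∀ N i c, F N i c ≤ G N i c) (hG : TailsOf G) : TailsOf F := by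
  intro a₀ θ₀ u₀ ha hθ hu ha0 hθ0
  obtain ⟨σ₀, hσ₀, H⟩ := hG a₀ θ₀ u₀ ha hθ hu ha0 hθ0
  refine ⟨σ₀, hσ₀, fun σ hσ hσlt T ρ θ u hE Φ hlim t ht => ?_⟩
  obtain ⟨V₀, hV₀, H⟩ := H σ hσ hσlt T ρ θ u hE Φ hlim t ht
  refine ⟨V₀, hV₀, fun V hV ε hε => ?_⟩
  obtain ⟨τ₀, hτ₀, H⟩ := H V hV ε hε
  refine ⟨τ₀, hτ₀, fun τ hτ => ?_⟩
  obtain ⟨N₀, H⟩ := H τ hτ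
  refine ⟨N₀, fun N hN s hs => (lintegral_mono_ae ?_).trans (H N hN s hs)⟩
  have hκ : 0 ≤ σ / τ := div_nonneg hσ.le (hτ₀.le.trans hτ)
  filter_upwards [ae_mem_good_localGibbsLaw σ a₀ θ₀ u₀ N (Φ N)] with z hz
  refine ENNReal.ofReal_le_ofReal (mul_le_mul_of_nonneg_left (Finset.sum_le_sum fun i _ => ?_)
    (by positivity))
  exact tail_mono (mul_nonneg hκ (collisionSum_nonneg (Φ N) _ (hF N i) z))
    (mul_le_mul_of_nonneg_left (collisionSum_mono_of_good (Φ N) hz _ _ (hFG N i)) hκ)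

/-- The momentum impulse is nonnegative. -/
theorem momentumOf_nonneg (N : ℕ) (i : Fin (N + 1)) (c : Rec N) : 0 ≤ momentumOf N i c := by
  unfold momentumOf; split_ifs <;> positivity

/-- The energy impulse is nonnegative. -/
theorem energyOf_nonneg (N : ℕ) (i : Fin (N + 1)) (c : Rec N) : 0 ≤ energyOf N i c := by
  unfold energyOf; split_ifs <;> positivity

/-- The transfer impulse is nonnegative. -/
theorem transferOf_nonneg (N : ℕ) (i : Fin (N + 1)) (c : Rec N) : 0 ≤ transferOf N i c := by
  unfold transferOf; split_ifs <;> positivity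

/-- The transfer impulse is the momentum impulse plus the energy impulse. -/
theorem transferOf_eq_add (N : ℕ) (i : Fin (N + 1)) (c : Rec N) :
    transferOf N i c = momentumOf N i c + energyOf N i c := by
  unfold transferOf momentumOf energyOf; split_ifs <;> simp

/-- The momentum impulse is dominated by the transfer impulse, record by record. -/
theorem momentumOf_le_transferOf (N : ℕ) (i : Fin (N + 1)) (c : Rec N) :
    momentumOf N i c ≤ transferOf N i c := by
  rw [transferOf_eq_add]; exact le_add_of_nonneg_right (energyOf_nonneg N i c)

/-- The energy impulse is dominated by the transfer impulse, record by record. -/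
theorem energyOf_le_transferOf (N : ℕ) (i : Fin (N + 1)) (c : Rec N) :
    energyOf N i c ≤ transferOf N i c := by
  rw [transferOf_eq_add]; exact le_add_of_nonneg_left (momentumOf_nonneg N i c)

/-- **The crux implies the momentum-activity tails** (ex-13734 / `OneFlightGossipEngine.CollisionActivityTails`). -/
theorem momentumActivityTails_of_crux
    (h : Summit.AtomisticToContinuum.HydrodynamicLimit.Theses.TwoClocks.TransferActivityTails) :
    MomentumActivityTails :=
  tailsOf_of_le momentumOf_nonneg momentumOf_le_transferOf (transferActivityTails_iff.1 h)

/-- **The crux implies the energy-activity tails.** -/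
theorem energyActivityTails_of_crux
    (h : Summit.AtomisticToContinuum.HydrodynamicLimit.Theses.TwoClocks.TransferActivityTails) :
    EnergyActivityTails :=
  tailsOf_of_le energyOf_nonneg energyOf_le_transferOf (transferActivityTails_iff.1 h)

/-- **16624 ⟺ 13734 ∧ twin**: the crux is EQUIVALENT to the conjunction of the momentum tails and the energy
tails (⇒ by domination; ⇐ is the landed `ClampedCurrentsDockTransferTails.stub_transferActivityTails`). -/
theorem transferActivityTails_iff_momentum_and_energy :
    Summit.AtomisticToContinuum.HydrodynamicLimit.Theses.TwoClocks.TransferActivityTails ↔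
      MomentumActivityTails ∧ EnergyActivityTails :=
  ⟨fun h => ⟨momentumActivityTails_of_crux h, energyActivityTails_of_crux h⟩,
    fun h => transferActivityTails_iff_dock.2
      (ClampedCurrentsDockTransferTails.stub_transferActivityTails (momentumActivityTails_iff_oneFlight.1 h.1)
        (energyActivityTails_iff_twin.1 h.2))⟩

/-- Contrapositive: a counterexample to the momentum-activity tails (ex-13734) refutes the crux. -/
theorem not_crux_of_not_momentum (h : ¬ MomentumActivityTails) :
    ¬ Summit.AtomisticToContinuum.HydrodynamicLimit.Theses.TwoClocks.TransferActivityTails :=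
  fun hc => h (momentumActivityTails_of_crux hc)

/-- Contrapositive: a counterexample to the energy-activity tails refutes the crux. -/
theorem not_crux_of_not_energy (h : ¬ EnergyActivityTails) :
    ¬ Summit.AtomisticToContinuum.HydrodynamicLimit.Theses.TwoClocks.TransferActivityTails :=
  fun hc => h (energyActivityTails_of_crux hc)

/-! ## §3 The equilibrium reduction (unconditional) -/

/-- **The equilibrium rung of `TailsOf F`** (constant profiles, window `(0, w]`, canonical Gibbs law,
profile-wise `σ₀`; the crux's integrand verbatim). -/
def EquilibriumTailsOf (F : (N : ℕ) → Fin (N + 1) → Rec N → ℝ) : Prop :=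
  ∀ (a₀ θ₀ : ℝ) (u₀ : V3), 0 < a₀ → 0 < θ₀ → ∃ σ₀ : ℝ, 0 < σ₀ ∧ ∀ σ : ℝ, 0 < σ → σ < σ₀ →
    ∀ Φ : (N : ℕ) → Flow σ N, ∃ V₀ : ℝ, 0 < V₀ ∧ ∀ V : ℝ, V₀ ≤ V → ∀ ε : ℝ, 0 < ε →
    ∃ τ₀ : ℝ, 0 < τ₀ ∧ ∀ τ : ℝ, τ₀ ≤ τ → ∃ N₀ : ℕ, ∀ N : ℕ, N₀ ≤ N →
      ∫⁻ z, ENNReal.ofReal (((N : ℝ) + 1)⁻¹ * ∑ i : Fin (N + 1),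
          Set.indicator {y : ℝ | V < y} (fun y => y)
            (σ / τ * (Φ N).collisionSum (Set.Ioc 0 (τ * ((N : ℝ) + 1) ^ (-(1 / 3 : ℝ)))) (F N i) z))
        ∂(localGibbsLaw σ (fun _ => a₀) (fun _ => u₀) (fun _ => θ₀) N (Φ N)) ≤ ENNReal.ofReal ε

/-- **Equilibrium transfer-activity tails** — the equilibrium rung of the crux, THE refutation target. -/
def EquilibriumTransferActivityTails : Prop := EquilibriumTailsOf transferOf

/-- The constant-profile LLN with a constant density, threshold `≤ 1/2`, probability clause. -/
def ConstantStateLLNStatement : Prop :=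
  ∀ (a₀ θ₀ : ℝ) (u₀ : V3), 0 < a₀ → 0 < θ₀ → ∃ σ₁ : ℝ, 0 < σ₁ ∧ σ₁ ≤ 1 / 2 ∧ ∀ σ : ℝ, 0 < σ → σ < σ₁ →
    ∃ r : ℝ, 0 < r ∧ ∀ Φ : (N : ℕ) → Flow σ N,
      (∀ N, IsProbabilityMeasure
        (localGibbsLaw σ (fun _ => a₀) (fun _ => u₀) (fun _ => θ₀) N (Φ N))) ∧
      TendstoHydroFieldsAt (fun N => localGibbsLaw σ (fun _ => a₀) (fun _ => u₀) (fun _ => θ₀) N (Φ N))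
        Φ (fun _ _ => r) (fun _ _ => u₀) (fun _ _ => θ₀) 0

/-- **The constant-profile LLN has a constant density** (`ρ₀` pinned to `rhoLim`, constant since `β ≡ 1`). -/
theorem constantStateLLN : ConstantStateLLNStatement := by
  intro a θ u ha hθ
  obtain ⟨σa, hσa, Ha⟩ := localGibbs_lln_holds (fun _ => a) (fun _ => θ) (fun _ => u)
    continuous_const continuous_const continuous_const (fun _ => ha) (fun _ => hθ)
  obtain ⟨σb, hσb, hσb2, Hb⟩ := density_zero_eq_rhoLim (a₀ := fun _ : T3 => a) (θ₀ := fun _ => θ)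
    (u₀ := fun _ => u) continuous_const continuous_const continuous_const (fun _ => ha)
    (fun _ => hθ)
  refine ⟨min σa σb, lt_min hσa hσb, (min_le_right _ _).trans hσb2, fun σ hσ hσlt => ?_⟩
  have hσa' : σ < σa := hσlt.trans_le (min_le_left _ _)
  have hσb' : σ < σb := hσlt.trans_le (min_le_right _ _)
  have hσ2 : σ < 1 / 2 := hσb'.trans_le hσb2
  set P := profileOf (fun _ : T3 => a) continuous_const (fun _ => ha) with hP
  obtain ⟨-, hpin⟩ := Hb σ hσ hσb'
  obtain ⟨ρ₀, hρc, hρpos, Hlln⟩ := Ha σ hσ hσa'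
  let Φ : (N : ℕ) → Flow σ N := fun N => Classical.choice (HardSphereFlow.nonempty_torus_holds (d := Fin 3)
    (hsDiameter_pos hσ N) ((hsDiameter_le hσ.le N).trans_lt (hσ2.trans_eq (by norm_num))) (N + 1))
  have hid : ρ₀ = rhoLim P σ :=
    hpin (fun _ => ρ₀) (fun _ _ => θ) (fun _ _ => u) Φ hρc (Hlln Φ).2
  have hconst : rhoLim P σ = fun _ => ρ₀ 0 := by
    funext x
    rw [hid]
    simp only [hP, rhoLim, profileOf_β]
  refine ⟨ρ₀ 0, hρpos 0, fun Ψ => ⟨(Hlln Ψ).1, ?_⟩⟩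
  have hT := (Hlln Ψ).2
  rw [hid, hconst] at hT
  exact hT

/-- **Equilibrium reduction (unconditional)**: every pre-shock tail statement implies its equilibrium rung. -/
theorem equilibriumTailsOf_of_tailsOf (F : (N : ℕ) → Fin (N + 1) → Rec N → ℝ) (h : TailsOf F) :
    EquilibriumTailsOf F := by
  intro a₀ θ₀ u₀ ha hθ
  obtain ⟨σc, hσc, hc⟩ := h (fun _ => a₀) (fun _ => θ₀) (fun _ => u₀) continuous_const
    continuous_const continuous_const (fun _ => ha) (fun _ => hθ)
  obtain ⟨σ₁, hσ₁, -, hl⟩ := constantStateLLN a₀ θ₀ u₀ ha hθ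
  refine ⟨min σc σ₁, lt_min hσc hσ₁, fun σ hσ hσlt Φ => ?_⟩
  have hσc' : σ < σc := hσlt.trans_le (min_le_left _ _)
  have hσ₁' : σ < σ₁ := hσlt.trans_le (min_le_right _ _)
  obtain ⟨r, hr, hlln⟩ := hl σ hσ hσ₁'
  obtain ⟨V₀, hV₀, H⟩ := hc σ hσ hσc' 1 (fun _ _ => r) (fun _ _ => θ₀) (fun _ _ => u₀)
    (isHardSphereEulerSolution_const σ 1 u₀ hr hθ) Φ (hlln Φ).2 0 ⟨le_rfl, one_pos⟩
  refine ⟨V₀, hV₀, fun V hV ε hε => ?_⟩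
  obtain ⟨τ₀, hτ₀, H⟩ := H V hV ε hε
  refine ⟨τ₀, hτ₀, fun τ hτ => ?_⟩
  obtain ⟨N₀, H⟩ := H τ hτ
  refine ⟨N₀, fun N hN => ?_⟩
  have key := H N hN 0 ⟨le_rfl, le_rfl⟩
  simpa only [zero_add] using key

/-- **The crux implies its equilibrium rung, unconditionally.** -/
theorem equilibriumTransferActivityTails_of_crux
    (h : Summit.AtomisticToContinuum.HydrodynamicLimit.Theses.TwoClocks.TransferActivityTails) :
    EquilibriumTransferActivityTails :=
  equilibriumTailsOf_of_tailsOf transferOf (transferActivityTails_iff.1 h)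

/-- Contrapositive: **any counterexample to the equilibrium rung refutes the crux.** -/
theorem not_transferActivityTails_of_not_equilibrium (h : ¬ EquilibriumTransferActivityTails) :
    ¬ Summit.AtomisticToContinuum.HydrodynamicLimit.Theses.TwoClocks.TransferActivityTails :=
  fun hc => h (equilibriumTransferActivityTails_of_crux hc)

/-! ## §4 Kinematics of the energy summand (why boosts and single fast particles do not bite)

The record is read off the post-collisional configuration: `postVel = (vᵢ, vⱼ)` and
`preVel = reflectVel n (vᵢ, vⱼ)`, `n = sepVec xᵢ xⱼ` (`HardSphereCollisionRecord.ofConfig`).  The energy jump of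
particle `i` is EXACTLY `⟪vᵢ − vⱼ, n⟫ ⟪vᵢ + vⱼ, n⟫ / ‖n‖²`; since `|⟪vᵢ − vⱼ, n⟫|/‖n‖ = ‖Δvᵢ‖` (momentum
impulse) and `⟪vᵢ + vⱼ, n⟫` is conserved by the collision, `|Δ‖vᵢ‖²|/2 = ‖Δvᵢ‖ · |⟪(vᵢ+vⱼ)/2, n̂⟫|`:
ENERGY IMPULSE = MOMENTUM IMPULSE × NORMAL CENTRE-OF-MASS SPEED.  Consequences: (i) not Galilean invariant — a
boost `U` shifts it by `⟪U, n̂⟫ ‖Δvᵢ‖`, so at `u₀ ≠ 0` the energy activity has mean `≈ (c√θ₀ + |u₀|)·ā`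
(harmless: `V₀` after `u₀`); (ii) a single fast sphere of speed `u` contributes `≲ u` per unit momentum
impulse, and dumps `u²/2` ONCE while thermalising (one-dump channel `≤ (σ/τ)·KE/(N+1) → 0`); energy
hyperactivity at bounded momentum activity needs persistently large `|V_cm·n̂|` at the SAME particle —
a relay (pinned, `L¹`-invisible) or a co-moving fast platoon (kinetic tails). -/

/-- **Energy jump under the elastic reflection law**: `‖v'‖² − ‖v‖² = −⟪v − w, n⟫⟪v + w, n⟫/‖n‖²` for
`(v', w') = reflectVel n (v, w)` (also at the junk value `n = 0`). -/
theorem reflectVel_energy_jump (n : V3) (p : V3 × V3) :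
    ‖(reflectVel n p).1‖ ^ 2 - ‖p.1‖ ^ 2 = -(⟪p.1 - p.2, n⟫_ℝ * ⟪p.1 + p.2, n⟫_ℝ) / ‖n‖ ^ 2 := by
  by_cases hn : n = 0
  · subst hn; simp
  have hn2 : ‖n‖ ^ 2 ≠ 0 := by positivity
  simp only [reflectVel]
  rw [norm_sub_sq_real, real_inner_smul_right, norm_smul, mul_pow, Real.norm_eq_abs, sq_abs, inner_sub_left,
    inner_add_left]
  field_simp
  ring

/-- **Energy jump of a collision record** read off a configuration: post minus pre kinetic energy of the first
particle is `⟪vᵢ − vⱼ, n⟫⟪vᵢ + vⱼ, n⟫/‖n‖²` (post-collisional velocities `vᵢ, vⱼ`, `n = sepVec xᵢ xⱼ`). -/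
theorem ofConfig_energy_jump (ε : ℝ) (z : Cfg N) (t : ℝ) (i j : Fin (N + 1)) :
    ‖(HardSphereCollisionRecord.ofConfig (Torus.geometry (Fin 3)) ε z t i j).postVel.1‖ ^ 2 -
        ‖(HardSphereCollisionRecord.ofConfig (Torus.geometry (Fin 3)) ε z t i j).preVel.1‖ ^ 2 =
      ⟪(z i).2 - (z j).2, (Torus.geometry (Fin 3)).sepVec (z i).1 (z j).1⟫_ℝ *
          ⟪(z i).2 + (z j).2, (Torus.geometry (Fin 3)).sepVec (z i).1 (z j).1⟫_ℝ /
        ‖(Torus.geometry (Fin 3)).sepVec (z i).1 (z j).1‖ ^ 2 := by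
  have h := reflectVel_energy_jump ((Torus.geometry (Fin 3)).sepVec (z i).1 (z j).1) ((z i).2, (z j).2)
  dsimp only at h
  show ‖(z i).2‖ ^ 2 - ‖(reflectVel ((Torus.geometry (Fin 3)).sepVec (z i).1 (z j).1) ((z i).2, (z j).2)).1‖ ^ 2 = _
  rw [neg_div] at h
  linarith

/-! ## §5 Load-bearing hypotheses and natural strengthenings (typed; verdicts in the docstrings) -/

/-- **No-threshold variant** (`V₀ = 0`: the MEAN window activity vanishes).  FALSE on paper at equilibrium:
by invariance of `G` and the virial theorem `E_G[a^m] = 6θ₀(Z−1) ≈ 4πσ³θ₀ > 0` for every `τ, N` (plus a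
positive energy part), so the mean does not vanish; not Lean-closable today (needs a collision-rate floor IN
MEAN along the flow: static tube lower bound — landed, `CollisionTubePairMeanLowerBound` — plus the missing
dynamic step "tube ∧ isolation ⇒ actual binary collision with the free-flight impulse" and an interference
bound).  A STRENGTHENING of `TailsOf F` (`tailsOf_of_noThreshold`): its falsity says only "any proof must use
`V₀ > 0`". -/
def TailsOfNoThreshold (F : (N : ℕ) → Fin (N + 1) → Rec N → ℝ) : Prop :=
  ∀ (a₀ θ₀ : T3 → ℝ) (u₀ : T3 → V3), Continuous a₀ → Continuous θ₀ → Continuous u₀ →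
    (∀ x, 0 < a₀ x) → (∀ x, 0 < θ₀ x) → ∃ σ₀ : ℝ, 0 < σ₀ ∧ ∀ σ : ℝ, 0 < σ → σ < σ₀ →
    ∀ (T : ℝ) (ρ θ : ℝ → T3 → ℝ) (u : ℝ → T3 → V3), IsHardSphereEulerSolution σ T ρ u θ →
    ∀ Φ : (N : ℕ) → Flow σ N,
    TendstoHydroFieldsAt (fun N => localGibbsLaw σ a₀ u₀ θ₀ N (Φ N)) Φ ρ u θ 0 →
    ∀ t ∈ Set.Ico 0 T, ∀ ε : ℝ, 0 < ε →
    ∃ τ₀ : ℝ, 0 < τ₀ ∧ ∀ τ : ℝ, τ₀ ≤ τ → ∃ N₀ : ℕ, ∀ N : ℕ, N₀ ≤ N → ∀ s ∈ Set.Icc 0 t,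
      ∫⁻ z, ENNReal.ofReal (((N : ℝ) + 1)⁻¹ * ∑ i : Fin (N + 1),
            (σ / τ * (Φ N).collisionSum (Set.Ioc s (s + τ * ((N : ℝ) + 1) ^ (-(1 / 3 : ℝ))))
              (F N i) z))
        ∂(localGibbsLaw σ a₀ u₀ θ₀ N (Φ N)) ≤ ENNReal.ofReal ε

/-- The no-threshold variant implies the tail statement (tail ≤ mean pointwise for a nonnegative summand). -/
theorem tailsOf_of_noThreshold {F : (N : ℕ) → Fin (N + 1) → Rec N → ℝ} (hF : ∀ N i c, 0 ≤ F N i c)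
    (h : TailsOfNoThreshold F) : TailsOf F := by
  intro a₀ θ₀ u₀ ha hθ hu ha0 hθ0
  obtain ⟨σ₀, hσ₀, H⟩ := h a₀ θ₀ u₀ ha hθ hu ha0 hθ0
  refine ⟨σ₀, hσ₀, fun σ hσ hσlt T ρ θ u hE Φ hlim t ht => ⟨1, one_pos, fun V _ ε hε => ?_⟩⟩
  obtain ⟨τ₀, hτ₀, H⟩ := H σ hσ hσlt T ρ θ u hE Φ hlim t ht ε hε
  refine ⟨τ₀, hτ₀, fun τ hτ => ?_⟩
  obtain ⟨N₀, H⟩ := H τ hτ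
  refine ⟨N₀, fun N hN s hs => (lintegral_mono fun z => ?_).trans (H N hN s hs)⟩
  have hκ : 0 ≤ σ / τ := div_nonneg hσ.le (hτ₀.le.trans hτ)
  refine ENNReal.ofReal_le_ofReal (mul_le_mul_of_nonneg_left (Finset.sum_le_sum fun i _ => ?_)
    (by positivity))
  exact tail_le_self (mul_nonneg hκ (collisionSum_nonneg (Φ N) _ (hF N i) z))

/-- **All-windows variant** (drop `τ → ∞`: every `τ > 0`).  FALSE on paper: for a window of `≪ 1` mean free
times (`τσ² ≪ 1`) a single collision already gives `a ≥ (σ/τ)‖Δv‖ ≫ V`, with probability `≍ τσ²`, so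
`E[a𝟙{a>V}] ≍ σ³·E‖Δv‖ > 0` uniformly in `N` — the long-window limit is load-bearing; not Lean-closable today
(same missing rate floor).  A STRENGTHENING (`tailsOf_of_allWindows`). -/
def TailsOfAllWindows (F : (N : ℕ) → Fin (N + 1) → Rec N → ℝ) : Prop :=
  ∀ (a₀ θ₀ : T3 → ℝ) (u₀ : T3 → V3), Continuous a₀ → Continuous θ₀ → Continuous u₀ →
    (∀ x, 0 < a₀ x) → (∀ x, 0 < θ₀ x) → ∃ σ₀ : ℝ, 0 < σ₀ ∧ ∀ σ : ℝ, 0 < σ → σ < σ₀ →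
    ∀ (T : ℝ) (ρ θ : ℝ → T3 → ℝ) (u : ℝ → T3 → V3), IsHardSphereEulerSolution σ T ρ u θ →
    ∀ Φ : (N : ℕ) → Flow σ N,
    TendstoHydroFieldsAt (fun N => localGibbsLaw σ a₀ u₀ θ₀ N (Φ N)) Φ ρ u θ 0 →
    ∀ t ∈ Set.Ico 0 T, ∃ V₀ : ℝ, 0 < V₀ ∧ ∀ V : ℝ, V₀ ≤ V → ∀ ε : ℝ, 0 < ε →
    ∀ τ : ℝ, 0 < τ → ∃ N₀ : ℕ, ∀ N : ℕ, N₀ ≤ N → ∀ s ∈ Set.Icc 0 t,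
      ∫⁻ z, ENNReal.ofReal (((N : ℝ) + 1)⁻¹ * ∑ i : Fin (N + 1),
          Set.indicator {y : ℝ | V < y} (fun y => y)
            (σ / τ * (Φ N).collisionSum (Set.Ioc s (s + τ * ((N : ℝ) + 1) ^ (-(1 / 3 : ℝ))))
              (F N i) z))
        ∂(localGibbsLaw σ a₀ u₀ θ₀ N (Φ N)) ≤ ENNReal.ofReal ε

/-- The all-windows variant implies the tail statement (take `τ₀ = 1`). -/
theorem tailsOf_of_allWindows {F : (N : ℕ) → Fin (N + 1) → Rec N → ℝ} (h : TailsOfAllWindows F) :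
    TailsOf F := by
  intro a₀ θ₀ u₀ ha hθ hu ha0 hθ0
  obtain ⟨σ₀, hσ₀, H⟩ := h a₀ θ₀ u₀ ha hθ hu ha0 hθ0
  refine ⟨σ₀, hσ₀, fun σ hσ hσlt T ρ θ u hE Φ hlim t ht => ?_⟩
  obtain ⟨V₀, hV₀, H⟩ := H σ hσ hσlt T ρ θ u hE Φ hlim t ht
  refine ⟨V₀, hV₀, fun V hV ε hε => ⟨1, one_pos, fun τ hτ => ?_⟩⟩
  exact H V hV ε hε τ (one_pos.trans_le hτ)

/-- **Exponential-moment (LD) strengthening at equilibrium** (typed refutation target, NOT the crux):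
`∃V₀ ∀V ≥ V₀ ∀β ∀ε ∃τ₀ ∀τ ∃N₀ ∀N`, `∫ exp(β Σᵢ aᵢ𝟙{aᵢ > V}) dG_N ≤ exp(ε(N+1))`.  FALSE — REFUTED IN LEAN:
`TransferActivityTailsNegative.transferActivityTailsExpMoment_false` (landed `Negative/ExpMomentLattice.lean` +
`Negative/ExpMomentFalse.lean`; this def is byte-identical with the landed
`TransferActivityTailsNegative.TransferActivityTailsExpMoment` up to unfolding `transferOf`).  Witness: the 13733
frozen line-lattice Newton-cradle event `Ev` (Gibbs weight `≥ (N+1)!·evB`, i.e. `exp(−C(N+1)·log(tl))` per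
labelling; `τ = t⁴`, `σ = (4/5)/l²`, `N + 1 = (ln)³`): every RECEIVER of a pulse transfer (`c ≥ clo ≍ t³`, target
speed `≤ u`) gets the energy impulse `(‖η + cn‖² − ‖η‖²)/2 ≥ clo(clo − 2u)/2 ≥ (9/80)t⁶`, hence transfer
activity `≥ (σ/τ)(9/80)t⁶ = (9/100)t²/l² > V`; receivers of distinct transfers are distinct and there are
`≥ (N+1)/6` transfers in the window, so `2·Σᵢaᵢ𝟙{aᵢ>V} ≥ Fmin N kw 1 1` (the 13733 exponent at `Z = 1`) and
`exp(N+1) < (N+1)!·exp(Fmin)·evB ≤ ∫ exp(2Σᵢaᵢ𝟙{aᵢ>V}) dG_N` contradicts the bound at `β = 2`, `ε = 1`.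
Under the crux's `L¹` currency the same event contributes `≤ G(Ev)·σt² → 0`: the relay does not bite the crux.
Moral (route text "the L¹ currency is forced", now a theorem): the clamp price MUST be asked in `L¹`, never in LD
currency; no line may consume an exponential concentration of the activity tail. -/
def TransferActivityTailsExpMoment : Prop :=
  ∀ (a₀ θ₀ : ℝ) (u₀ : V3), 0 < a₀ → 0 < θ₀ → ∃ σ₀ : ℝ, 0 < σ₀ ∧ ∀ σ : ℝ, 0 < σ → σ < σ₀ →
    ∀ Φ : (N : ℕ) → Flow σ N, ∃ V₀ : ℝ, 0 < V₀ ∧ ∀ V : ℝ, V₀ ≤ V → ∀ β : ℝ, 0 < β → ∀ ε : ℝ, 0 < ε →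
    ∃ τ₀ : ℝ, 0 < τ₀ ∧ ∀ τ : ℝ, τ₀ ≤ τ → ∃ N₀ : ℕ, ∀ N : ℕ, N₀ ≤ N →
      ∫⁻ z, ENNReal.ofReal (Real.exp (β * ∑ i : Fin (N + 1),
          Set.indicator {y : ℝ | V < y} (fun y => y)
            (σ / τ * (Φ N).collisionSum (Set.Ioc 0 (τ * ((N : ℝ) + 1) ^ (-(1 / 3 : ℝ))))
              (transferOf N i) z)))
        ∂(localGibbsLaw σ (fun _ => a₀) (fun _ => u₀) (fun _ => θ₀) N (Φ N)) ≤
        ENNReal.ofReal (Real.exp (ε * ((N : ℝ) + 1)))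

/-! ## §6 Targets

No line is picked for this crux yet (`PICKED.md` absent, `stuck_stubs = []`): nothing to attack stub-wise this
cycle.  When a line registers, its stubs become `-- Targets` here; first checks to run on any stub: (i) is it a
`TailsOf`/`EquilibriumTailsOf` instance (then §2–§3 apply and its equilibrium rung is the target), (ii) does it
ask for concentration in LD currency (then §5's relay kills it), (iii) does it consume a raw collision COUNT
without a cluster-size exclusion (exposed to the Burago–Ivanov count heavy tail, ideator NOTES §1). -/

end Summit.AtomisticToContinuum.HydrodynamicLimit.Cruxes.TransferActivityTails.Disproof

end
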